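import Summits.ABC.IUTFork.Repair.RHOffSigmaTolerance
import Summits.ABC.IUTFork.Conditional.AbcOfCor312SlackBudget
import HarnessLib

/-!
# R-H ROUND 2, Q1′ (ii) — THE THRESHOLD AT A DATUM and THE abc CONSTANT AS AN EXPLICIT FUNCTION OF THE MARGIN: for an off-Σ bound `B`
# with «Cor. 3.12 up to `B`», the regimes `B ≤ Tol` (print's constants), `B ≤ Tol + s` (`η_prm ↦ η_prm + 4s/(5(l+1))`, `C_K ↦ C_K + 32s/(l+1) ≤ C_K + 4s`),
# `B ≤ κ·gap + Tol` (display DILATED by `1−κ`: exponent currency), `B ≥ gap` (empty)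

PROOF + bookkeeping file of the abc-iut cell, rung LADDER-ABC:A2.RESCUE.H, R-H ROUND 2 Q1′ (ii) (director-abc g3 2026-08-26T22:18:18Z «the THRESHOLD T such
that "S on Σ" ⟹ nontrivial abc iff Σ-mass > T, abc constant as an explicit function of the margin»; rh-lead g2 22:41:51Z; MIN-SLICE.md v0.5 §(ii)). Seat
abc-iut-rh2-T-1 (threshold typer); companions `Repair/RHSigmaMass.lean` (generic mass bookkeeping, `massThreshold`) and `Conditional/AbcOfSigmaMass.lean`
(the `ABC` endpoint for a general Σ). Composed BY NAME from abc-iut-rh2-q2-cond `Conditional.Cor312Slack` (p469667 `display_of_squeezeIII_slack(')`,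
`display_arith`, `seven_le_of_prime_of_ne_five`; p470412 `Cor22.isEtaPrm_mono`) and abc-iut-rh2-xi-1 `Repair.RH.OffSigma` (p469145 `OffSigmaTolerance`,
`logQAvoid_le_of_cor312UpTo`); abc-iut-S-d2 `PointDict.gap_eq`.

WHAT IS TYPED, at a genuine datum `T` of an admissible `(P, l)` (`l ≥ 5` prime, `l ≠ 5`), for an off-Σ bound `B` with «Cor. 3.12 up to `B`»
(`T.negAbsLogQ − B ≤ T.negLogTheta` — what «S on Σ» delivers with `B = B_triv(Σᶜ)`, companion files) and the hull estimate with `B_III(P,l)`: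
* `tol P l := ((l+1)/4)·5·d*·l` (`d* = 2¹²·3³·5·d_mod`; abc-iut-rh2-q2-cond's `η`-free NO-LOSS tolerance of record, rh-lead ruling R11, NAMED);
  **`gapThreshold T := T.gap − Tol(P,l)`** — MIN-SLICE (ii)'s `T(P,l,T) = M − Tol` with the total trivial mass `M` read as
  `T.gap = ((l+1)/24 − 1/(2l))·log(q^{∤{2,l}})` (the bed identity `totalTrivialMass = T.gap` is abc-iut-rh2-w-1's item (i), not restated);
  `gapThreshold_le_iff`: `gapThreshold T ≤ T.gap − B ⟺ B ≤ Tol` («retained mass ≥ threshold» IS «off-Σ bound within tolerance»);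
* (R0) `display_of_offBound_le_tol` / `display_of_gapThreshold_le`: `B ≤ Tol` ⟹ print's display `Cor22.Display P l η_prm` UNCHANGED;
* (R1) **`etaShift l s := 4·s⁺/(5(l+1))`** and **`display_of_shortfall`**: `B ≤ Tol + s` ⟹ `Cor22.Display P l (η_prm + etaShift l s)`; in [IUTchIV] Cor. 2.2 (ii)
  (C2) `C_K = 40·η_prm + 2·B_K` this is **`C_K ↦ C_K + 32·s⁺/(l+1) ≤ C_K + 4·s⁺`** (`forty_mul_etaShift_eq/_le`; q2-cond p474212 «+4K»), `H_unif = 2^140`, `H_K`,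
  `ε_E` untouched — THE CONSTANT AS AN EXPLICIT FUNCTION OF THE SHORTFALL `s = T − mass(Σ)`; `display_of_gapThreshold_shortfall` (threshold form);
* (R2) `displayIneq_of_squeeze` ([IUTchIV] Thm. 1.10 Step (viii) with print's constants for a FREE height variable `Q` — q2-cond's arithmetic, credited) and
  **`dilatedDisplay_of_offSigmaTolerance`**: `OffSigmaTolerance κ (Tol(P,l)) T B` (`B ≤ κ·T.gap + Tol`) ⟹
  `(1/6)·((1−κ)·log q) ≤ (1 + 20·d_mod/l)·(log-diff + log-cond) + 20·(d*·l + η_prm)` — `1/6 ↦ (1−κ)/6`, the EXPONENT currency (downstream `(1+ε)/(1−κ)`;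
  q2-cond p473109: `κ ≤ 30·d*/l` is still no loss inside Cor. 2.2 (ii)'s window `l ≥ √(log q∀)`);
* (R∅) `squeeze_of_gap_le_offBound`: `T.gap ≤ B` ⟹ the squeeze holds for free — an off-Σ bound at or above the whole gap carries no information.
READING (numbers, MIN-SLICE §(ii)): `Tol/M ≈ 30·d*·l/log(q)`; inside the window (`l > 2^70`) the retained mass must be all but `≈ 1.4·10⁻¹⁴·d_mod` of `M`.
HONEST FRAMING: pure bookkeeping of a disputed inequality's consequences; nothing here asserts that abc is proved or refuted, or that [IUTchIII] Cor. 3.12 /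
[IUTchIV] Thm. 1.10 holds or fails at any datum; no side taken on any author; typed ≠ proved; instantiated ≠ endorsed.
[cite: Mochizuki2012, IUTchIV Thm. 1.10 pp. 22–31, Steps (vii)–(x) p. 30–32, last paragraph p. 31; Prop. 1.6 p. 16; Cor. 2.2 (ii) pp. 41–48, (C2) p. 47]
[cite: Mochizuki2012, IUTchIII Cor. 3.12 p. 174] [claim: Mochizuki2012, status: disputed] for every IUT locution. Axioms: standard.
-/

noncomputable section

open Set Function NumberField IsDedekindDomain

namespace Summit.ABC.IUTFork.Conditional.SigmaMass

open Literature.IUT.LogVolume Literature.IUT.HodgeTheaters Literature.NumberTheory.DiophantineGeometry.GenEll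
open Summit.ABC.ABC.Theorems Summit.ABC.IUTFork.Conditional

/-! ## The tolerance, the datum threshold, and the regimes (R0) constant kept · (R1) constant shifted · (R2) exponent dilated · (R∅) empty -/

section Datum

/-- **`Tol(P,l) := ((l+1)/4)·5·d*_mod·l`**, `d*_mod = 2¹²·3³·5·d_mod` — abc-iut-rh2-q2-cond's `η`-free NO-LOSS tolerance of record (p469667
`Cor312Slack.display_of_squeezeIII_slack'`; rh-lead ruling R11), NAMED. In `−|log(Θ)|`/squeeze currency `= 691200·d_mod·l(l+1)`.
[cite: Mochizuki2012, IUTchIV Thm. 1.10 Step (viii) p. 30–31] [claim: Mochizuki2012, status: disputed] -/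
def tol (P : NFPoint) (l : ℕ) : ℝ :=
  ((l : ℝ) + 1) / 4 * (5 * ((((2 ^ 12 * 3 ^ 3 * 5 * Cor22.dmod P : ℕ) : ℝ)) * l))

/-- **The datum threshold `T(P,l,T) := T.gap − Tol(P,l)`** (MIN-SLICE (ii); `T.gap = deĝ̲_lgp(P_Θ) − deĝ̲(P_q) = ((l+1)/24 − 1/(2l))·log(q^{∤{2,l}})`
read as the total trivial mass `M` of the datum). [cite: Mochizuki2012, IUTchIV Thm. 1.10 Steps (viii)–(x) p. 30–32] [claim: Mochizuki2012, status: disputed] -/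
def gapThreshold {P : NFPoint} {l : ℕ} (T : Cor22.ThetaVolumeDatumAt P l) : ℝ :=
  T.gap - tol P l

/-- **The `η_prm`-shift that pays a shortfall `s` below the threshold**: `etaShift l s := 4·s⁺/(5·(l+1))` — a budget `s` of off-Σ mass beyond `Tol`
is absorbed by running [IUTchIV] Thm. 1.10 Step (viii) at `η_prm + etaShift l s` (abc-iut-rh2-q2-cond's budget device p470555/p474212); in Cor. 2.2 (ii)
(C2) `C_K = 40·η_prm + 2·B_K` moves by `40·etaShift l s = 32·s⁺/(l+1) ≤ 4·s⁺` (`l ≥ 7`). [cite: Mochizuki2012, IUTchIV Prop. 1.6 p. 16; Cor. 2.2 (ii) p. 47]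
[claim: Mochizuki2012, status: disputed] -/
def etaShift (l : ℕ) (s : ℝ) : ℝ :=
  4 * max s 0 / (5 * ((l : ℝ) + 1))

variable {P : NFPoint} {l : ℕ}

/-- `Tol(P,l)` unfolds to `((l+1)/4)·5·d*·l`. [folklore] -/
theorem tol_eq : tol P l = ((l : ℝ) + 1) / 4 * (5 * ((((2 ^ 12 * 3 ^ 3 * 5 * Cor22.dmod P : ℕ) : ℝ)) * l)) := rfl

/-- `Tol(P,l) ≥ 0`. [folklore] -/
theorem tol_nonneg : 0 ≤ tol P l := by
  unfold tol; positivity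

/-- `etaShift l s ≥ 0`. [folklore] -/
theorem etaShift_nonneg (s : ℝ) : 0 ≤ etaShift l s := by
  unfold etaShift; positivity

/-- The shift PAYS the shortfall: `s ≤ ((l+1)/4)·5·etaShift l s`. [folklore] -/
theorem le_tolCoeff_mul_etaShift (s : ℝ) : s ≤ ((l : ℝ) + 1) / 4 * (5 * etaShift l s) := by
  unfold etaShift
  have hl : (0 : ℝ) < (l : ℝ) + 1 := by positivity
  have e : ((l : ℝ) + 1) / 4 * (5 * (4 * max s 0 / (5 * ((l : ℝ) + 1)))) = max s 0 := by
    field_simp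
  rw [e]
  exact le_max_left _ _

/-- **THE CONSTANT AS A FUNCTION OF THE MARGIN**: `40·etaShift l s = 32·s⁺/(l+1) ≤ 4·s⁺` for `l ≥ 7` — the increment of (C2)'s `C_K = 40·η_prm + 2·B_K`
that a shortfall `s` costs (abc-iut-rh2-q2-cond p474212 «`C_K ↦ C_K + 4K`»). [cite: Mochizuki2012, IUTchIV Cor. 2.2 (ii) p. 47] -/
theorem forty_mul_etaShift_le (hl7 : 7 ≤ l) (s : ℝ) : 40 * etaShift l s ≤ 4 * max s 0 := by
  unfold etaShift
  have hl : (7 : ℝ) ≤ l := by exact_mod_cast hl7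
  have hl0 : (0 : ℝ) < 5 * ((l : ℝ) + 1) := by positivity
  have hm : 0 ≤ max s 0 := le_max_right _ _
  rw [mul_div_assoc', div_le_iff₀ hl0]
  nlinarith

/-- `40·etaShift l s = 32·s⁺/(l+1)` exactly. [folklore] -/
theorem forty_mul_etaShift_eq (s : ℝ) : 40 * etaShift l s = 32 * max s 0 / ((l : ℝ) + 1) := by
  unfold etaShift
  have hl : (0 : ℝ) < (l : ℝ) + 1 := by positivity
  field_simp
  ring

/-- **THRESHOLD READING AT THE DATUM**: `gapThreshold T ≤ T.gap − B ⟺ B ≤ Tol(P,l)` — «retained mass ≥ T» IS «off-Σ bound within tolerance».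
[folklore] -/
theorem gapThreshold_le_iff (T : Cor22.ThetaVolumeDatumAt P l) (B : ℝ) : gapThreshold T ≤ T.gap - B ↔ B ≤ tol P l := by
  unfold gapThreshold
  constructor <;> intro h <;> linarith

/-- **(R0) CONSTANT KEPT.** At an admissible `(P, l)` (`l ≥ 5` prime, `l ≠ 5`), a genuine datum `T` with «Cor. 3.12 up to `B`» (`T.negAbsLogQ − B ≤ T.negLogTheta`),
the hull estimate with `B_III(P,l)` and `B ≤ Tol(P,l)` give print's display `Cor22.Display P l η_prm` UNCHANGED (xi-1 `logQAvoid_le_of_cor312UpTo` + q2-cond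
`display_of_squeezeIII_slack'`). Threshold form: `gapThreshold T ≤ T.gap − B`. CONDITIONAL bookkeeping; no side taken.
[cite: Mochizuki2012, IUTchIV Thm. 1.10 Steps (vii)–(viii) p. 30–31] [claim: Mochizuki2012, status: disputed] -/
theorem display_of_offBound_le_tol (hl : l.Prime) (h5 : 5 ≤ l) (hne : l ≠ 5) {η : ℝ} (hη : IsEtaPrm η) (T : Cor22.ThetaVolumeDatumAt P l)
    (hU : P.InU) {B : ℝ} (h1 : T.negAbsLogQ - B ≤ T.negLogTheta)
    (h2 : T.HullEstimateOf
      (((l : ℝ) + 1) / 4 *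
        ((1 + 12 * (Cor22.dmod P : ℝ) / l) * (P.logDiff + Cor22.logCondAvoid P {2, l})
          + 2 * Real.log l + 52
          + 20 / 3 * Real.log (((2 ^ 12 * 3 ^ 3 * 5 * Cor22.dmod P : ℕ) : ℝ) * (l : ℝ))
            * (Nat.primeCounting (2 ^ 12 * 3 ^ 3 * 5 * Cor22.dmod P * l) : ℝ))))
    (hB : B ≤ tol P l) : Cor22.Display P l η :=
  Cor312Slack.display_of_squeezeIII_slack' hl h5 hne hη hB (Repair.RH.OffSigma.logQAvoid_le_of_cor312UpTo T hU h1 h2)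

/-- (R0), threshold form: `gapThreshold T ≤ T.gap − B` in place of `B ≤ Tol`. [claim: Mochizuki2012, status: disputed] -/
theorem display_of_gapThreshold_le (hl : l.Prime) (h5 : 5 ≤ l) (hne : l ≠ 5) {η : ℝ} (hη : IsEtaPrm η) (T : Cor22.ThetaVolumeDatumAt P l)
    (hU : P.InU) {B : ℝ} (h1 : T.negAbsLogQ - B ≤ T.negLogTheta)
    (h2 : T.HullEstimateOf
      (((l : ℝ) + 1) / 4 *
        ((1 + 12 * (Cor22.dmod P : ℝ) / l) * (P.logDiff + Cor22.logCondAvoid P {2, l})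
          + 2 * Real.log l + 52
          + 20 / 3 * Real.log (((2 ^ 12 * 3 ^ 3 * 5 * Cor22.dmod P : ℕ) : ℝ) * (l : ℝ))
            * (Nat.primeCounting (2 ^ 12 * 3 ^ 3 * 5 * Cor22.dmod P * l) : ℝ))))
    (hT : gapThreshold T ≤ T.gap - B) : Cor22.Display P l η :=
  display_of_offBound_le_tol hl h5 hne hη T hU h1 h2 ((gapThreshold_le_iff T B).mp hT)

/-- **(R1) CONSTANT SHIFTED — the abc constant as an explicit function of the shortfall.** Same data, but the off-Σ bound exceeds the tolerance by a
shortfall `s`: `B ≤ Tol(P,l) + s`. Then print's display holds AT `η_prm + etaShift l s` (`etaShift l s = 4·s⁺/(5(l+1))`, `IsEtaPrm` by q2-cond's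
`Cor22.isEtaPrm_mono`), i.e. with `C_K ↦ C_K + 32·s⁺/(l+1) ≤ C_K + 4·s⁺` in Cor. 2.2 (ii) (C2) and NOTHING else moved (`H_unif = 2^140`, `H_K`, `ε_E`).
Honest scope: a UNIFORM shortfall (the same `s` at every admissible datum) is what the global certificate §3 consumes; a datum-dependent `s(P,l,T)` that is
`o(l)` is still inside the window's no-loss bin (q2-cond p473109), one growing like `κ·T.gap` is (R2). [cite: Mochizuki2012, IUTchIV Thm. 1.10 Step (viii)
p. 30–31; Prop. 1.6 p. 16; Cor. 2.2 (ii) p. 47] [claim: Mochizuki2012, status: disputed] -/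
theorem display_of_shortfall (hl : l.Prime) (h5 : 5 ≤ l) (hne : l ≠ 5) {η : ℝ} (hη : IsEtaPrm η) (T : Cor22.ThetaVolumeDatumAt P l)
    (hU : P.InU) {B s : ℝ} (h1 : T.negAbsLogQ - B ≤ T.negLogTheta)
    (h2 : T.HullEstimateOf
      (((l : ℝ) + 1) / 4 *
        ((1 + 12 * (Cor22.dmod P : ℝ) / l) * (P.logDiff + Cor22.logCondAvoid P {2, l})
          + 2 * Real.log l + 52
          + 20 / 3 * Real.log (((2 ^ 12 * 3 ^ 3 * 5 * Cor22.dmod P : ℕ) : ℝ) * (l : ℝ))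
            * (Nat.primeCounting (2 ^ 12 * 3 ^ 3 * 5 * Cor22.dmod P * l) : ℝ))))
    (hB : B ≤ tol P l + s) : Cor22.Display P l (η + etaShift l s) := by
  have hη' : IsEtaPrm (η + etaShift l s) := Cor22.isEtaPrm_mono hη (by linarith [etaShift_nonneg (l := l) s])
  refine Cor312Slack.display_of_squeezeIII_slack hl h5 hne hη' (E := B) ?_ (Repair.RH.OffSigma.logQAvoid_le_of_cor312UpTo T hU h1 h2)
  have hη0 : 0 < η := hη.1
  have hc : (0 : ℝ) ≤ ((l : ℝ) + 1) / 4 := by positivity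
  have hs := le_tolCoeff_mul_etaShift (l := l) s
  have e : ((l : ℝ) + 1) / 4 * (5 * ((((2 ^ 12 * 3 ^ 3 * 5 * Cor22.dmod P : ℕ) : ℝ)) * l + (η + etaShift l s))) =
      tol P l + ((l : ℝ) + 1) / 4 * (5 * η) + ((l : ℝ) + 1) / 4 * (5 * etaShift l s) := by
    unfold tol; ring
  rw [e]
  nlinarith

/-- (R1), threshold form: shortfall `s := gapThreshold T − (T.gap − B)` (how far the retained mass falls below the threshold) ⟹ the display at
`η_prm + etaShift l s`. [claim: Mochizuki2012, status: disputed] -/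
theorem display_of_gapThreshold_shortfall (hl : l.Prime) (h5 : 5 ≤ l) (hne : l ≠ 5) {η : ℝ} (hη : IsEtaPrm η)
    (T : Cor22.ThetaVolumeDatumAt P l) (hU : P.InU) {B : ℝ} (h1 : T.negAbsLogQ - B ≤ T.negLogTheta)
    (h2 : T.HullEstimateOf
      (((l : ℝ) + 1) / 4 *
        ((1 + 12 * (Cor22.dmod P : ℝ) / l) * (P.logDiff + Cor22.logCondAvoid P {2, l})
          + 2 * Real.log l + 52
          + 20 / 3 * Real.log (((2 ^ 12 * 3 ^ 3 * 5 * Cor22.dmod P : ℕ) : ℝ) * (l : ℝ))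
            * (Nat.primeCounting (2 ^ 12 * 3 ^ 3 * 5 * Cor22.dmod P * l) : ℝ)))) :
    Cor22.Display P l (η + etaShift l (gapThreshold T - (T.gap - B))) :=
  display_of_shortfall hl h5 hne hη T hU h1 h2 (s := gapThreshold T - (T.gap - B)) (by unfold gapThreshold; linarith)

/-- **[IUTchIV] Thm. 1.10 Step (viii) with print's constants, for a FREE height variable `Q`** (abc-iut-rh2-q2-cond's `display_of_squeezeIII_slack`,
p469667, with `log(q^{∤{2,l}})` replaced by an arbitrary real `Q` — the same arithmetic, credited): `l ≥ 5` prime, `l ≠ 5`, `IsEtaPrm η`,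
`E ≤ ((l+1)/4)·5·(d*·l + η)` and the squeeze `((l+1)/24 − 1/(2l))·Q ≤ B_III(P,l) + E + ((l+5)/4)·log π` ⟹
`(1/6)·Q ≤ (1 + 20·d_mod/l)·(log-diff + log-cond) + 20·(d*·l + η)`. Used with `Q := (1−κ)·log(q)` in (R2). Pure arithmetic; no side taken.
[cite: Mochizuki2012, IUTchIV Thm. 1.10 Steps (vii)–(viii) p. 30–31, last paragraph p. 31; Prop. 1.6 p. 16] [claim: Mochizuki2012, status: disputed] -/
theorem displayIneq_of_squeeze (hl : l.Prime) (h5 : 5 ≤ l) (hne : l ≠ 5) {η : ℝ} (hη : IsEtaPrm η) {E Q : ℝ}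
    (hE : E ≤ ((l : ℝ) + 1) / 4 * (5 * ((((2 ^ 12 * 3 ^ 3 * 5 * Cor22.dmod P : ℕ) : ℝ)) * l + η)))
    (hineq : (((l : ℝ) + 1) / 24 - 1 / (2 * l)) * Q ≤
      ((l : ℝ) + 1) / 4 *
          ((1 + 12 * (Cor22.dmod P : ℝ) / l) * (P.logDiff + Cor22.logCondAvoid P {2, l})
            + 2 * Real.log l + 52
            + 20 / 3 * Real.log (((2 ^ 12 * 3 ^ 3 * 5 * Cor22.dmod P : ℕ) : ℝ) * (l : ℝ))
              * (Nat.primeCounting (2 ^ 12 * 3 ^ 3 * 5 * Cor22.dmod P * l) : ℝ))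
        + E + ThetaVolumeInput.archLogTheta l) :
    1 / 6 * Q ≤ (1 + 20 * (Cor22.dmod P : ℝ) / l) * (P.logDiff + Cor22.logCondAvoid P {2, l})
      + 20 * (2 ^ 12 * 3 ^ 3 * 5 * (Cor22.dmod P : ℝ) * l + η) := by
  have hLD : 0 ≤ P.logDiff := P.logDiff_nonneg
  have hLC : 0 ≤ Cor22.logCondAvoid P {2, l} := Cor22.logCondAvoid_nonneg P {2, l}
  have h7 : 7 ≤ l := Cor312Slack.seven_le_of_prime_of_ne_five hl h5 hne
  have hl7 : (7 : ℝ) ≤ l := by exact_mod_cast h7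
  have hl0 : (0 : ℝ) < l := by linarith
  have hd1 : (1 : ℝ) ≤ (Cor22.dmod P : ℝ) := by exact_mod_cast Cor22.dmod_pos P
  have hη0 : 0 < η := hη.1
  have hDst : (((2 ^ 12 * 3 ^ 3 * 5 * Cor22.dmod P : ℕ) : ℝ)) = 552960 * (Cor22.dmod P : ℝ) := by
    push_cast; ring
  have hDst0 : (0 : ℝ) < (((2 ^ 12 * 3 ^ 3 * 5 * Cor22.dmod P : ℕ) : ℝ)) := by rw [hDst]; positivity
  have hE₁0 : 0 < (((2 ^ 12 * 3 ^ 3 * 5 * Cor22.dmod P : ℕ) : ℝ)) * l + η := by positivity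
  by_cases hq : 0 < Q
  swap
  · -- `Q ≤ 0`: the right-hand side is nonnegative
    have hq' : Q ≤ 0 := not_lt.1 hq
    have ha : 0 ≤ (1 + 20 * (Cor22.dmod P : ℝ) / l) * (P.logDiff + Cor22.logCondAvoid P {2, l}) := by positivity
    have hb : 0 ≤ 20 * (2 ^ 12 * 3 ^ 3 * 5 * (Cor22.dmod P : ℝ) * l + η) := by positivity
    linarith
  -- Prop. 1.6 (proved in the tree): `log(d*·l)·π(d*·l) ≤ (4/3)·(d*·l + η)`
  have hpnt : Real.log ((((2 ^ 12 * 3 ^ 3 * 5 * Cor22.dmod P : ℕ) : ℝ)) * (l : ℝ))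
      * (Nat.primeCounting (2 ^ 12 * 3 ^ 3 * 5 * Cor22.dmod P * l) : ℝ) ≤
      4 / 3 * ((((2 ^ 12 * 3 ^ 3 * 5 * Cor22.dmod P : ℕ) : ℝ)) * l + η) := by
    have h0 : (0 : ℝ) ≤ (((2 ^ 12 * 3 ^ 3 * 5 * Cor22.dmod P : ℕ) : ℝ)) * l := by positivity
    have h2 := log_mul_primeCounting_le_of_isEtaPrm hη h0
    rwa [show ⌊(((2 ^ 12 * 3 ^ 3 * 5 * Cor22.dmod P : ℕ) : ℝ)) * (l : ℝ)⌋₊ = 2 ^ 12 * 3 ^ 3 * 5 * Cor22.dmod P * l by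
      exact_mod_cast Nat.floor_natCast (2 ^ 12 * 3 ^ 3 * 5 * Cor22.dmod P * l)] at h2
  -- the constant `d*` as an opaque atom `N`
  generalize hN : (((2 ^ 12 * 3 ^ 3 * 5 * Cor22.dmod P : ℕ) : ℝ)) = N at hE hineq hpnt hDst hDst0 hE₁0 ⊢
  -- Step (viii)'s absorption `2·log l + 56 ≤ (4/9)·(d*·l + η)`
  have habs : 2 * Real.log (l : ℝ) + 56 ≤ 4 / 9 * (N * l + η) := by
    have hlogl : Real.log (l : ℝ) ≤ (l : ℝ) - 1 := Real.log_le_sub_one_of_pos hl0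
    have hprod : (552960 : ℝ) * l ≤ N * l := by
      rw [hDst]
      exact mul_le_mul_of_nonneg_right (by nlinarith) hl0.le
    linarith
  -- Step (vii): `(l+5)/4·log π ≤ (l+1)/4·4`
  have harch : ThetaVolumeInput.archLogTheta l ≤ ((l : ℝ) + 1) / 4 * 4 := by
    unfold ThetaVolumeInput.archLogTheta
    have hpi := log_pi_le_two
    have h1 : ((l : ℝ) + 5) / 4 * Real.log Real.pi ≤ ((l : ℝ) + 5) / 4 * 2 :=
      mul_le_mul_of_nonneg_left hpi (by positivity)
    linarith
  -- the prime-counting atom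
  set W : ℝ := 20 / 3 * Real.log (N * (l : ℝ)) * (Nat.primeCounting (2 ^ 12 * 3 ^ 3 * 5 * Cor22.dmod P * l) : ℝ) with hW
  have hW' : W ≤ 20 / 3 * (4 / 3 * (N * l + η)) := by
    rw [hW, mul_assoc]
    exact mul_le_mul_of_nonneg_left hpnt (by norm_num)
  have hc : (0 : ℝ) < ((l : ℝ) + 1) / 4 := by positivity
  have h1 : (((l : ℝ) + 1) / 24 - 1 / (2 * l)) * Q ≤
      ((l : ℝ) + 1) / 4 * ((1 + 12 * (Cor22.dmod P : ℝ) / l) * (P.logDiff + Cor22.logCondAvoid P {2, l})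
        + 2 * Real.log l + 52 + W + 5 * (N * l + η) + 4) := by
    have e : ((l : ℝ) + 1) / 4 * ((1 + 12 * (Cor22.dmod P : ℝ) / l) * (P.logDiff + Cor22.logCondAvoid P {2, l})
        + 2 * Real.log l + 52 + W + 5 * (N * l + η) + 4) =
        ((l : ℝ) + 1) / 4 * ((1 + 12 * (Cor22.dmod P : ℝ) / l) * (P.logDiff + Cor22.logCondAvoid P {2, l})
          + 2 * Real.log l + 52 + W)
          + ((l : ℝ) + 1) / 4 * (5 * (N * l + η)) + ((l : ℝ) + 1) / 4 * 4 := by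
      ring
    rw [e]
    linarith
  have hcoef : ((l : ℝ) + 1) / 4 * (1 / 6 * (1 - 12 / (l : ℝ) ^ 2)) ≤ ((l : ℝ) + 1) / 24 - 1 / (2 * l) := by
    have hdiff : ((l : ℝ) + 1) / 24 - 1 / (2 * l) - ((l : ℝ) + 1) / 4 * (1 / 6 * (1 - 12 / (l : ℝ) ^ 2))
        = 1 / (2 * (l : ℝ) ^ 2) := by
      field_simp
      ring
    have hpos : (0 : ℝ) ≤ 1 / (2 * (l : ℝ) ^ 2) := by positivity
    linarith
  have h2 : ((l : ℝ) + 1) / 4 * (1 / 6 * (1 - 12 / (l : ℝ) ^ 2) * Q) ≤ (((l : ℝ) + 1) / 24 - 1 / (2 * l)) * Q := by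
    calc ((l : ℝ) + 1) / 4 * (1 / 6 * (1 - 12 / (l : ℝ) ^ 2) * Q)
        = ((l : ℝ) + 1) / 4 * (1 / 6 * (1 - 12 / (l : ℝ) ^ 2)) * Q := by ring
      _ ≤ (((l : ℝ) + 1) / 24 - 1 / (2 * l)) * Q := mul_le_mul_of_nonneg_right hcoef hq.le
  have h3 : 1 / 6 * (1 - 12 / (l : ℝ) ^ 2) * Q ≤
      (1 + 12 * (Cor22.dmod P : ℝ) / l) * (P.logDiff + Cor22.logCondAvoid P {2, l})
        + 2 * Real.log l + 52 + W + 5 * (N * l + η) + 4 :=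
    le_of_mul_le_mul_left (le_trans h2 h1) hc
  have h4 : 1 / 6 * (1 - 12 / (l : ℝ) ^ 2) * Q ≤
      (1 + 12 * (Cor22.dmod P : ℝ) / l) * (P.logDiff + Cor22.logCondAvoid P {2, l}) + 129 / 9 * (N * l + η) := by
    linarith [hW', habs, h3]
  have h5' := Cor312Slack.display_arith hl7 hd1 (add_nonneg hLD hLC) hq hE₁0 h4
  have e4 : 2 ^ 12 * 3 ^ 3 * 5 * (Cor22.dmod P : ℝ) * l + η = N * l + η := by
    rw [hDst]; ring
  rw [e4]
  exact h5'

/-- **(R2) EXPONENT DILATED.** At an admissible `(P, l)`, a genuine datum `T` with «Cor. 3.12 up to `B`», the hull estimate with `B_III`, and abc-iut-rh2-xi-1's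
RELATIVE tolerance `OffSigmaTolerance κ (Tol(P,l)) T B` (`B ≤ κ·T.gap + Tol`) give, for ANY `κ` (content only for `κ < 1`), the DILATED display
`(1/6)·((1−κ)·log(q^{∤{2,l}})) ≤ (1 + 20·d_mod/l)·(log-diff + log-cond) + 20·(d*·l + η_prm)` — print's display with `1/6` replaced by `(1−κ)/6`
(mass form: `mass(σ) ≥ (1−κ)·M − Tol`). Downstream this is the EXPONENT currency (`1+ε ↦ (1+ε)/(1−κ)` for a fixed `κ`; abc-iut-rh2-q2-cond p473109:
`κ ≤ 30·d*/l` costs nothing inside Cor. 2.2 (ii)'s window). CONDITIONAL bookkeeping; no side taken.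
[cite: Mochizuki2012, IUTchIV Thm. 1.10 Steps (viii)–(x) p. 30–32; Cor. 2.2 (ii) p. 46] [claim: Mochizuki2012, status: disputed] -/
theorem dilatedDisplay_of_offSigmaTolerance (hl : l.Prime) (h5 : 5 ≤ l) (hne : l ≠ 5) {η : ℝ} (hη : IsEtaPrm η)
    (T : Cor22.ThetaVolumeDatumAt P l) (hU : P.InU) {B κ : ℝ}
    (htol : Repair.RH.OffSigma.OffSigmaTolerance κ (tol P l) T B) (h1 : T.negAbsLogQ - B ≤ T.negLogTheta)
    (h2 : T.HullEstimateOf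
      (((l : ℝ) + 1) / 4 *
        ((1 + 12 * (Cor22.dmod P : ℝ) / l) * (P.logDiff + Cor22.logCondAvoid P {2, l})
          + 2 * Real.log l + 52
          + 20 / 3 * Real.log (((2 ^ 12 * 3 ^ 3 * 5 * Cor22.dmod P : ℕ) : ℝ) * (l : ℝ))
            * (Nat.primeCounting (2 ^ 12 * 3 ^ 3 * 5 * Cor22.dmod P * l) : ℝ)))) :
    1 / 6 * ((1 - κ) * Cor22.logQAvoid P {2, l}) ≤
      (1 + 20 * (Cor22.dmod P : ℝ) / l) * (P.logDiff + Cor22.logCondAvoid P {2, l})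
        + 20 * (2 ^ 12 * 3 ^ 3 * 5 * (Cor22.dmod P : ℝ) * l + η) := by
  have hsq := Repair.RH.OffSigma.logQAvoid_le_of_cor312UpTo T hU h1 h2
  have hgap := PointDict.gap_eq T hU
  unfold Repair.RH.OffSigma.OffSigmaTolerance at htol
  rw [hgap] at htol
  have hη0 : 0 < η := hη.1
  have hc : (0 : ℝ) ≤ ((l : ℝ) + 1) / 4 := by positivity
  refine displayIneq_of_squeeze hl h5 hne hη (E := tol P l) ?_ ?_
  · unfold tol
    exact mul_le_mul_of_nonneg_left (by nlinarith) hc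
  · -- `g(l)·((1−κ)·Q) = g(l)·Q − κ·(g(l)·Q) ≤ B_III + Tol + arch`
    have e : (((l : ℝ) + 1) / 24 - 1 / (2 * l)) * ((1 - κ) * Cor22.logQAvoid P {2, l}) =
        (((l : ℝ) + 1) / 24 - 1 / (2 * l)) * Cor22.logQAvoid P {2, l}
          - κ * ((((l : ℝ) + 1) / 24 - 1 / (2 * l)) * Cor22.logQAvoid P {2, l}) := by ring
    rw [e]
    linarith

/-- **(R∅) THE EMPTY REGIME (content line).** If the off-Σ bound is at least the datum's whole gap, `T.gap ≤ B` (retained mass `≤ Tol`'s worth of nothing: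
`T.gap − B ≤ 0`), then the squeeze `T.gap ≤ δ + B + ((l+5)/4)·log π` holds for every `δ ≥ 0` WITHOUT any hypothesis — such a certificate says
nothing about the datum (xi-1's `cor312UpTo_trivial` in threshold form; the pre-registered bin «ρ ≥ 1: squeeze EMPTY»). [folklore] -/
theorem squeeze_of_gap_le_offBound (T : Cor22.ThetaVolumeDatumAt P l) {B δ : ℝ} (hB : T.gap ≤ B) (hδ : 0 ≤ δ) :
    T.gap ≤ δ + B + ThetaVolumeInput.archLogTheta l := by
  have ha := (ThetaVolumeInput.archLogTheta_pos l).le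
  linarith

end Datum

/-! ## (v2 append, abc-iut-rh2-T-1 2026-08-27, referee rh2-ref-3 precision note P1) The two budget currencies are ONE -/

section Units

variable {l : ℕ}

/-- **UNITS (rh2-ref-3 P1): the `η`-budget `K` of the endpoints (`Tol_K = Tol + ((l+1)/4)·5·K`, constant `C_K + 40K`) and the NAT-shortfall `s` of (R1)
(`etaShift l s = 4s⁺/(5(l+1))`, constant `C_K + 32s⁺/(l+1)`) agree under `s = ((l+1)/4)·5·K`: `etaShift l (((l+1)/4)·5·K) = K` for `K ≥ 0`** — so «+40K» and
«+4s» are the same price in different units (`40K = 32s/(l+1)`), not a factor-10 discrepancy. [folklore] -/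
theorem etaShift_tolCoeff_mul {K : ℝ} (hK : 0 ≤ K) : etaShift l (((l : ℝ) + 1) / 4 * (5 * K)) = K := by
  unfold etaShift
  have hl : (0 : ℝ) < (l : ℝ) + 1 := by positivity
  have hm : max (((l : ℝ) + 1) / 4 * (5 * K)) 0 = ((l : ℝ) + 1) / 4 * (5 * K) := max_eq_left (by positivity)
  rw [hm]
  field_simp

/-- … and conversely a shortfall of `s ≥ 0` nats is the `η`-budget `K = etaShift l s` with `((l+1)/4)·5·K = s`. [folklore] -/
theorem tolCoeff_mul_etaShift_eq {s : ℝ} (hs : 0 ≤ s) : ((l : ℝ) + 1) / 4 * (5 * etaShift l s) = s := by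
  unfold etaShift
  have hl : (0 : ℝ) < (l : ℝ) + 1 := by positivity
  rw [max_eq_left hs]
  field_simp

/-- The constant increments agree: `40·K = 32·s/(l+1)` when `s = ((l+1)/4)·5·K`. [folklore] -/
theorem forty_mul_eq_thirtytwo_div (K : ℝ) : 40 * K = 32 * (((l : ℝ) + 1) / 4 * (5 * K)) / ((l : ℝ) + 1) := by
  have hl : (0 : ℝ) < (l : ℝ) + 1 := by positivity
  field_simp
  ring

end Units

end Summit.ABC.IUTFork.Conditional.SigmaMass

end
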